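import Literature.Analysis.UnboundedOperators.HilleYosidaRescaled
import Mathlib.Analysis.SpecificLimits.Normed
import Mathlib.Tactic.NoncommRing
import HarnessLib

/-!
# The Hille–Yosida generation theorem, part 5: bounded perturbations of the generator
  (Engel–Nagel III Thm. 1.3, quasi-contractive case, through the perturbed pseudo-resolvent)

Analysis/UnboundedOperators support file (two definitions with bodies, everything proved, no
named facts), continuing `HilleYosidaRescaled.lean`. Engel–Nagel (2000), Ch. III Thm. 1.3
(Bounded Perturbation Theorem): if `A` generates a C₀-semigroup with `‖T(t)‖ ≤ Me^{ωt}` and `K` is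
bounded, then `A + K` (domain `D(A)`) generates a C₀-semigroup with `‖S(t)‖ ≤ Me^{(ω + M‖K‖)t}`.
Here: the case `M = 1`, for the closed operator `A = operatorOfResolvent J z₀` of an injective
pseudo-resolvent (Kato VIII-§1.1), via RESOLVENTS — for `‖KJ(σ)‖ < 1` the perturbed family

  `J_K(σ) := J(σ)(1 − KJ(σ))⁻¹`  (Neumann series; Kato IV-(1.13) / Engel–Nagel III (1.4))

is again a pseudo-resolvent (§1: `isPseudoResolvent_perturb`), with the same range as `J`
(§1: `range_perturb`), it is the resolvent of `A + K` (§2: `operatorOfResolvent_perturb_apply`,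
`operatorOfResolvent_perturb_domain`: `operatorOfResolvent J_K z₀ = A + K` on `D(A)`), and the
Hille–Yosida bound `‖J(λ)‖ ≤ 1/(λ + m)` passes to `‖J_K(λ)‖ ≤ 1/(λ + m − b)` for `‖K‖ ≤ b`
(§1: `norm_perturb_le_inv`). Hence (§3, **`exists_c0Semigroup_perturb`**, from
`exists_c0Semigroup_of_resolvent_bound`): `A + K` generates a C₀-semigroup `S` with
**`‖S(t)‖ ≤ e^{(b − m)t}`**, Laplace transform `J_K` and generator `operatorOfResolvent J_K z₀`
(`= A + K`).

Use in the tree: the FULL sheet linearisation `−DG(Ω*) = T + θℓ(·)f` (selfsim `generatorOdd` plus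
the rank-one gauge feedback) — `Summits/…/OSWSelfSimilar/SheetRLinearisedFlow.lean`.

## References

* K.-J. Engel, R. Nagel, *One-Parameter Semigroups for Linear Evolution Equations* (2000),
  Ch. III Thm. 1.3 (Bounded Perturbation Theorem) and (1.4) (the resolvent of `A + B`).
  [EngelNagel2000]
* T. Kato, *Perturbation Theory for Linear Operators* (1966), IV-§1.3 (1.13), IX-§2.1 (Thm. 2.1:
  bounded perturbation of a generator), VIII-§1.1. [Kato1966]
-/

noncomputable section

open NormedSpace Filter Set Metric Literature.Analysis.OperatorTheory
open scoped Topology NNReal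

namespace Literature.Analysis.UnboundedOperators

namespace HilleYosida

variable {E : Type*} [NormedAddCommGroup E] [NormedSpace ℂ E] [CompleteSpace E]
variable {U : Set ℂ} {J : ℂ → E →L[ℂ] E} {K : E →L[ℂ] E}

/-! ### §1 The perturbed pseudo-resolvent `J_K(σ) = J(σ)(1 − KJ(σ))⁻¹` -/

/-- **The Neumann inverse `(1 − KJ(σ))⁻¹ = ∑ₙ (KJ(σ))ⁿ`** (junk value `0` when `‖KJ(σ)‖ ≥ 1`, where
nothing is claimed). [cite: Kato1966, IV-§1.3 (1.13)] -/
def neumannInv (J : ℂ → E →L[ℂ] E) (K : E →L[ℂ] E) (σ : ℂ) : E →L[ℂ] E :=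
  if h : ‖K * J σ‖ < 1 then ((Units.oneSub (K * J σ) h)⁻¹ : (E →L[ℂ] E)ˣ) else 0

/-- **The perturbed pseudo-resolvent `J_K(σ) := J(σ)(1 − KJ(σ))⁻¹`** — the resolvent of `A + K`
(Engel–Nagel III (1.4): `R(λ, A + B) = R(λ, A)(1 − BR(λ, A))⁻¹`). [cite: EngelNagel2000, Ch. III (1.4)] -/
def perturb (J : ℂ → E →L[ℂ] E) (K : E →L[ℂ] E) (σ : ℂ) : E →L[ℂ] E := J σ * neumannInv J K σ

/-- `(1 − KJ(σ)) (1 − KJ(σ))⁻¹ = 1`. [cite: Kato1966, IV-§1.3 (1.13)] -/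
theorem one_sub_mul_neumannInv {σ : ℂ} (hσ : ‖K * J σ‖ < 1) : (1 - K * J σ) * neumannInv J K σ = 1 := by
  rw [neumannInv, dif_pos hσ]
  exact (Units.oneSub (K * J σ) hσ).mul_inv

/-- `(1 − KJ(σ))⁻¹ (1 − KJ(σ)) = 1`. [cite: Kato1966, IV-§1.3 (1.13)] -/
theorem neumannInv_mul_one_sub {σ : ℂ} (hσ : ‖K * J σ‖ < 1) : neumannInv J K σ * (1 - K * J σ) = 1 := by
  rw [neumannInv, dif_pos hσ]
  exact (Units.oneSub (K * J σ) hσ).inv_mul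

/-- `W = 1 + KJ(σ)W` for `W = (1 − KJ(σ))⁻¹`. [cite: Kato1966, IV-§1.3 (1.13)] -/
theorem neumannInv_eq_one_add {σ : ℂ} (hσ : ‖K * J σ‖ < 1) :
    neumannInv J K σ = 1 + K * J σ * neumannInv J K σ := by
  have h := one_sub_mul_neumannInv (J := J) (K := K) hσ
  rw [sub_mul, one_mul, sub_eq_iff_eq_add] at h
  exact h

/-- `W = 1 + WKJ(σ)` for `W = (1 − KJ(σ))⁻¹`. [cite: Kato1966, IV-§1.3 (1.13)] -/
theorem neumannInv_eq_one_add' {σ : ℂ} (hσ : ‖K * J σ‖ < 1) :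
    neumannInv J K σ = 1 + neumannInv J K σ * (K * J σ) := by
  have h := neumannInv_mul_one_sub (J := J) (K := K) hσ
  rw [mul_sub, mul_one, sub_eq_iff_eq_add] at h
  exact h

/-- **Neumann bound**: `‖(1 − KJ(σ))⁻¹‖ ≤ (1 − ‖KJ(σ)‖)⁻¹`. [cite: Kato1966, IV-§1.3 (1.13)] -/
theorem norm_neumannInv_le {σ : ℂ} (hσ : ‖K * J σ‖ < 1) : ‖neumannInv J K σ‖ ≤ (1 - ‖K * J σ‖)⁻¹ := by
  rw [neumannInv, dif_pos hσ]
  have h := tsum_geometric_le_of_norm_lt_one (K * J σ) hσ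
  have h1 : ‖(1 : E →L[ℂ] E)‖ ≤ 1 := ContinuousLinearMap.norm_id_le
  have heq : (((Units.oneSub (K * J σ) hσ)⁻¹ : (E →L[ℂ] E)ˣ) : E →L[ℂ] E) = ∑' n : ℕ, (K * J σ) ^ n := rfl
  rw [heq]
  linarith

/-- `J_K(σ)(1 − KJ(σ)) = J(σ)`. [cite: EngelNagel2000, Ch. III (1.4)] -/
theorem perturb_mul_one_sub {σ : ℂ} (hσ : ‖K * J σ‖ < 1) : perturb J K σ * (1 - K * J σ) = J σ := by
  rw [perturb, mul_assoc, neumannInv_mul_one_sub hσ, mul_one]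

/-- `J_K(σ) = J(σ) + J_K(σ)KJ(σ)` (the second resolvent identity between `A + K` and `A`).
[cite: EngelNagel2000, Ch. III (1.4)] -/
theorem perturb_eq_add {σ : ℂ} (hσ : ‖K * J σ‖ < 1) : perturb J K σ = J σ + perturb J K σ * (K * J σ) := by
  have h := perturb_mul_one_sub (J := J) (K := K) hσ
  rw [mul_sub, mul_one, sub_eq_iff_eq_add] at h
  exact h

/-- Norm bound: `‖J_K(σ)‖ ≤ ‖J(σ)‖(1 − ‖KJ(σ)‖)⁻¹`. [cite: EngelNagel2000, Ch. III Thm. 1.3 proof] -/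
theorem norm_perturb_le {σ : ℂ} (hσ : ‖K * J σ‖ < 1) : ‖perturb J K σ‖ ≤ ‖J σ‖ * (1 - ‖K * J σ‖)⁻¹ :=
  (norm_mul_le _ _).trans (mul_le_mul_of_nonneg_left (norm_neumannInv_le hσ) (norm_nonneg _))

/-- **The range is unchanged**: `Ran J_K(σ) = Ran J(σ)` (`(1 − KJ(σ))⁻¹` is a bijection), so `A + K`
has the domain of `A`. [cite: EngelNagel2000, Ch. III Thm. 1.3] -/
theorem range_perturb {σ : ℂ} (hσ : ‖K * J σ‖ < 1) : Set.range (perturb J K σ) = Set.range (J σ) := by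
  have hsurj : Function.Surjective (neumannInv J K σ) := by
    intro y
    refine ⟨(1 - K * J σ) y, ?_⟩
    rw [← mul_apply_eq_comp, neumannInv_mul_one_sub hσ, one_apply_eq_self]
  rw [perturb, ContinuousLinearMap.mul_def, ContinuousLinearMap.coe_comp, Set.range_comp, hsurj.range_eq,
    Set.image_univ]

/-- `J_K(σ)` is injective when `J(σ)` is. [cite: Kato1966, VIII-§1.1] -/
theorem injective_perturb {σ : ℂ} (hσ : ‖K * J σ‖ < 1) (hinj : Function.Injective (J σ)) :
    Function.Injective (perturb J K σ) := by
  have hW : Function.Injective (neumannInv J K σ) := by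
    intro x y hxy
    have h : ((1 - K * J σ) * neumannInv J K σ) x = ((1 - K * J σ) * neumannInv J K σ) y := by
      rw [mul_apply_eq_comp, mul_apply_eq_comp, hxy]
    rwa [one_sub_mul_neumannInv hσ, one_apply_eq_self, one_apply_eq_self] at h
  rw [perturb, ContinuousLinearMap.mul_def, ContinuousLinearMap.coe_comp]
  exact hinj.comp hW

/-- The natural domain of the perturbed family: `σ ∈ U` with `‖KJ(σ)‖ < 1`. [cite: EngelNagel2000, Ch. III Thm. 1.3] -/
def perturbSet (U : Set ℂ) (J : ℂ → E →L[ℂ] E) (K : E →L[ℂ] E) : Set ℂ := {σ | σ ∈ U ∧ ‖K * J σ‖ < 1}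

/-- **`J_K` is a pseudo-resolvent** on `{σ ∈ U : ‖KJ(σ)‖ < 1}`: `J_K(z) − J_K(w) = (w − z)J_K(z)J_K(w)`
(it is the resolvent of the single operator `A + K`; algebraic proof from the resolvent identity of
`J` and `W_z = 1 + W_zKJ(z)`). [cite: Kato1966, VIII-§1.1] -/
theorem isPseudoResolvent_perturb (hJ : IsPseudoResolvent U J) :
    IsPseudoResolvent (perturbSet U J K) (perturb J K) := by
  intro z hz w hw
  obtain ⟨hzU, hzs⟩ := hz
  obtain ⟨hwU, hws⟩ := hw
  -- it suffices to check the identity after multiplying by the invertible `1 − K J w` on the right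
  have hcancel : ∀ X Y : E →L[ℂ] E, X * (1 - K * J w) = Y * (1 - K * J w) → X = Y := by
    intro X Y hXY
    have h := congrArg (fun Z : E →L[ℂ] E => Z * neumannInv J K w) hXY
    simp only [mul_assoc, one_sub_mul_neumannInv hws, mul_one] at h
    exact h
  apply hcancel
  have hid := hJ hzU hwU
  -- `J z W_z = J z + J z W_z K J z`
  have hzW : perturb J K z = J z + perturb J K z * (K * J z) := perturb_eq_add hzs
  rw [sub_mul, perturb_mul_one_sub hws, smul_mul_assoc, mul_assoc, perturb_mul_one_sub hws]
  -- goal: `J_K z (1 − K J w) − J w = (w − z) • (J_K z * J w)`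
  calc perturb J K z * (1 - K * J w) - J w
      = perturb J K z - perturb J K z * (K * J w) - J w := by rw [mul_sub, mul_one]
    _ = (J z + perturb J K z * (K * J z)) - perturb J K z * (K * J w) - J w := by rw [← hzW]
    _ = (1 + perturb J K z * K) * (J z - J w) := by noncomm_ring
    _ = (1 + perturb J K z * K) * ((w - z) • (J z * J w)) := by rw [hid]
    _ = (w - z) • ((1 + perturb J K z * K) * (J z * J w)) := by rw [mul_smul_comm]
    _ = (w - z) • ((J z + perturb J K z * (K * J z)) * J w) := by congr 1
    _ = (w - z) • (perturb J K z * J w) := by rw [← hzW]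

/-! ### §1b The Hille–Yosida bound passes to the perturbation -/

omit [CompleteSpace E] in
/-- For real `λ > b − m`: `‖KJ(λ)‖ ≤ b/(λ + m) < 1` when `‖K‖ ≤ b`, `‖J(λ)‖ ≤ 1/(λ + m)`.
[cite: EngelNagel2000, Ch. III Thm. 1.3 proof] -/
theorem norm_mul_resolvent_lt_one {m b : ℝ} (hK : ‖K‖ ≤ b)
    (hbound : ∀ l : ℝ, -m < l → ‖J l‖ ≤ (l + m)⁻¹) {l : ℝ} (hl : b - m < l) : ‖K * J l‖ < 1 := by
  have hb : 0 ≤ b := (norm_nonneg _).trans hK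
  have hlm : 0 < l + m := by linarith
  calc ‖K * J l‖ ≤ ‖K‖ * ‖J l‖ := norm_mul_le _ _
    _ ≤ b * (l + m)⁻¹ := mul_le_mul hK (hbound l (by linarith)) (norm_nonneg _) hb
    _ < 1 := by rw [← div_eq_mul_inv, div_lt_one hlm]; linarith

/-- **`‖J_K(λ)‖ ≤ 1/(λ + m − b)`** for real `λ > b − m` (from `‖J(λ)‖ ≤ 1/(λ + m)`, `‖K‖ ≤ b`): the
Hille–Yosida bound for `A + K` with `m` replaced by `m − b`. [cite: EngelNagel2000, Ch. III Thm. 1.3 proof] -/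
theorem norm_perturb_le_inv {m b : ℝ} (hK : ‖K‖ ≤ b)
    (hbound : ∀ l : ℝ, -m < l → ‖J l‖ ≤ (l + m)⁻¹) {l : ℝ} (hl : -(m - b) < l) :
    ‖perturb J K l‖ ≤ (l + (m - b))⁻¹ := by
  have hb : 0 ≤ b := (norm_nonneg _).trans hK
  have hl' : b - m < l := by linarith
  have hlm : 0 < l + m := by linarith
  have hlmb : 0 < l + m - b := by linarith
  have hs := norm_mul_resolvent_lt_one hK hbound hl'
  have hKJ : ‖K * J l‖ ≤ b * (l + m)⁻¹ :=
    (norm_mul_le _ _).trans (mul_le_mul hK (hbound l (by linarith)) (norm_nonneg _) hb)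
  calc ‖perturb J K l‖ ≤ ‖J l‖ * (1 - ‖K * J l‖)⁻¹ := norm_perturb_le hs
    _ ≤ (l + m)⁻¹ * (1 - b * (l + m)⁻¹)⁻¹ := by
        refine mul_le_mul (hbound l (by linarith)) ?_ (inv_nonneg.2 (by linarith [hs.le])) (inv_nonneg.2 hlm.le)
        have h1 : 0 < 1 - b * (l + m)⁻¹ := by
          rw [← div_eq_mul_inv, sub_pos, div_lt_one hlm]; linarith
        exact inv_anti₀ h1 (by linarith)
    _ = (l + (m - b))⁻¹ := by
        rw [← mul_inv, mul_sub, mul_one, ← div_eq_mul_inv, mul_div_cancel₀ _ hlm.ne']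
        ring

/-! ### §2 `J_K` is the resolvent of `A + K` -/

/-- **`operatorOfResolvent J_K z₀ = A + K` on `D(A)`**: for `u ∈ D(A) = Ran J(z₀)` (which is also
`Ran J_K(z₀)`), the closed operator of the perturbed family acts as `Au + Ku`.
[cite: EngelNagel2000, Ch. III Thm. 1.3] -/
theorem operatorOfResolvent_perturb_apply {z₀ : ℂ} (hσ : ‖K * J z₀‖ < 1) (hinj : Function.Injective (J z₀))
    {u : E} (hu : u ∈ (operatorOfResolvent J z₀ hinj).domain) :
    ∃ hu' : u ∈ (operatorOfResolvent (perturb J K) z₀ (injective_perturb hσ hinj)).domain,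
      operatorOfResolvent (perturb J K) z₀ (injective_perturb hσ hinj) ⟨u, hu'⟩ =
        operatorOfResolvent J z₀ hinj ⟨u, hu⟩ + K u := by
  -- `u = J z₀ w` with `A u = z₀ u − w`; write `w = W v`, `v = (1 − K J z₀) w`, so `u = J_K z₀ v`
  obtain ⟨w, hw, hA⟩ := exists_eq_apply_of_mem_domain (J := J) (hinj := hinj) hu
  set v : E := (1 - K * J z₀) w with hv
  have hWv : neumannInv J K z₀ v = w := by
    rw [hv, ← mul_apply_eq_comp, neumannInv_mul_one_sub hσ, one_apply_eq_self]
  have huv : perturb J K z₀ v = u := by rw [perturb, mul_apply_eq_comp, hWv, hw]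
  have hu' : u ∈ (operatorOfResolvent (perturb J K) z₀ (injective_perturb hσ hinj)).domain := by
    rw [← huv]; exact apply_mem_domain _ v
  refine ⟨hu', ?_⟩
  have hB := operatorOfResolvent_apply (J := perturb J K) (z₀ := z₀) (hinj := injective_perturb hσ hinj) v
  have heq : (⟨perturb J K z₀ v, apply_mem_domain (injective_perturb hσ hinj) v⟩ :
      (operatorOfResolvent (perturb J K) z₀ (injective_perturb hσ hinj)).domain) = ⟨u, hu'⟩ := Subtype.ext huv
  rw [heq] at hB
  rw [hB, hA, huv]
  -- `z₀ u − v = z₀ u − w + K u`, i.e. `w − v = K u = K J z₀ w`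
  have hKu : K u = w - v := by
    rw [hv, sub_apply, one_apply_eq_self, mul_apply_eq_comp, hw]; abel
  rw [hKu]; abel

/-- The domains agree: `D(A + K) = D(A)`. [cite: EngelNagel2000, Ch. III Thm. 1.3] -/
theorem operatorOfResolvent_perturb_domain {z₀ : ℂ} (hσ : ‖K * J z₀‖ < 1) (hinj : Function.Injective (J z₀)) :
    ((operatorOfResolvent (perturb J K) z₀ (injective_perturb hσ hinj)).domain : Set E) =
      (operatorOfResolvent J z₀ hinj).domain := by
  rw [operatorOfResolvent_domain, operatorOfResolvent_domain, LinearMap.coe_range, LinearMap.coe_range,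
    ContinuousLinearMap.coe_coe, ContinuousLinearMap.coe_coe, range_perturb hσ]

/-! ### §3 Bounded perturbation of a quasi-contractive generator -/

/-- **Bounded Perturbation Theorem (Engel–Nagel III.1.3, case `M = 1`, pseudo-resolvent form).**
Let `J` be a pseudo-resolvent on `U ⊇ (−m, ∞)` with `‖J(λ)‖ ≤ 1/(λ + m)` for real `λ > −m` and dense
range (so `A = operatorOfResolvent J` generates a semigroup with `‖T(t)‖ ≤ e^{−mt}`), and let `K` be
bounded with `‖K‖ ≤ b`. Then there is a C₀-semigroup `S` with **`‖S(t)‖ ≤ e^{(b − m)t}`** whose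
Laplace transform is the perturbed resolvent `J_K(σ) = J(σ)(1 − KJ(σ))⁻¹` on
`{σ ∈ U : ‖KJ(σ)‖ < 1, Re σ > b − m}` and whose generator is `operatorOfResolvent J_K z₀` — which is
`A + K` on `D(A)` (`operatorOfResolvent_perturb_apply`). [cite: EngelNagel2000, Ch. III Thm. 1.3] -/
theorem exists_c0Semigroup_perturb (hJ : IsPseudoResolvent U J) {m b : ℝ}
    (hmem : ∀ l : ℝ, -m < l → (l : ℂ) ∈ U) (hbound : ∀ l : ℝ, -m < l → ‖J l‖ ≤ (l + m)⁻¹) (hK : ‖K‖ ≤ b)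
    {z₀ : ℂ} (hz₀ : z₀ ∈ U) (hz₀' : -(m - b) < z₀.re) (hσ : ‖K * J z₀‖ < 1) (hdense : Dense (Set.range (J z₀))) :
    ∃ hinj : Function.Injective (perturb J K z₀), ∃ S : C0Semigroup ℂ E,
      (∀ t : ℝ≥0, ‖S.app t‖ ≤ Real.exp (-(m - b) * t)) ∧
      (∀ l ∈ U, -(m - b) < l.re → ‖K * J l‖ < 1 → ∀ x : E, S.laplaceResolventFun l x = perturb J K l x) ∧
      S.generator = operatorOfResolvent (perturb J K) z₀ hinj := by
  have hb : 0 ≤ b := (norm_nonneg _).trans hK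
  have hmem' : ∀ l : ℝ, -(m - b) < l → (l : ℂ) ∈ perturbSet U J K := fun l hl =>
    ⟨hmem l (by linarith), norm_mul_resolvent_lt_one hK hbound (by linarith)⟩
  have hz₀mem : z₀ ∈ perturbSet U J K := ⟨hz₀, hσ⟩
  have hdense' : Dense (Set.range (perturb J K z₀)) := by rw [range_perturb hσ]; exact hdense
  obtain ⟨S, hS, hlap, hgen⟩ := exists_c0Semigroup_of_resolvent_bound (isPseudoResolvent_perturb hJ) hmem'
    (fun l hl => norm_perturb_le_inv hK hbound hl) hz₀mem hz₀' hdense'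
  exact ⟨_, S, hS, fun l hlU hl hs x => hlap l ⟨hlU, hs⟩ hl x, hgen⟩

end HilleYosida

end Literature.Analysis.UnboundedOperators
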